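import Literature.Analysis.FluidPDE.HeatDivFormTopImprovement
import Literature.Analysis.FluidPDE.NSGaldiDualityBounds
import HarnessLib

/-!
# The interior `L²` gradient estimate for `∂ₜw - Δw = div g`, up to the top of the cylinder

Analysis/FluidPDE proofs file (theorems only; no definitions, no named facts). It supplies the
first-order gain that every higher-regularity bootstrap for the heat equation with a
divergence-form right-hand side starts from (Ladyzhenskaya–Solonnikov–Ural'tseva 1968, Ch. III,
§2, (2.1)–(2.2), the energy inequality for weak solutions; Lieberman 1996, Thm. 6.1; in the
Navier–Stokes context Robinson–Rodrigo–Sadowski 2016, proof of Thm. 13.7, §13.3.2, and Serrin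
1962, where the vorticity `ω` and then `∇ω, ∇²ω, …` are estimated through the vorticity equation
`∂ₜω - Δω = div(ω ⊗ u - u ⊗ ω)`): **a distributional solution `w ∈ L²` of `∂ₜw - Δw = div g` with
`g ∈ L²` on a cylinder `]-L, 0[ × B(0, ρ)` has a weak spatial gradient in `L²` on every inner
cylinder `]-L', 0[ × B(0, ρ')` sharing the top, with
`‖∂ᵥw‖_{L²(inner)} ≤ C(L, L', ρ, ρ') ‖v‖ (‖w‖_{L²} + ‖g‖_{L²})`** (`heatDivForm_gradient_L2_top`).
The constant is fixed before the solution (it depends on the geometry only), which is the form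
needed for regularity statements with the dependence of the norms on the data
(`NSBoundedHigherRegularityBounds`).

## Proof (by duality with the `L²` maximal regularity of the backward Duhamel integral)

No Steklov averages and no energy identity for the (merely square integrable) solution are used.
Instead, for a test function `Ξ` supported in the inner cylinder and a direction `v`, the weak
equation is tested — through the accepted localisation identity
`HeatDivForm.integral_cutoff_mul_mul_test_eq_of_test` (RRS (13.11)–(13.12)) with a cut-off `φ`
reaching over the top — against `φ 𝒰[∂ᵥΞ]`, where `𝒰 = heatDuhamelBack 1` is the backward caloric
Duhamel integral of the tree (`∂ₛ𝒰[Θ] + Δ𝒰[Θ] = -Θ`). Since `𝒰[∂ᵥΞ] = ∂ᵥ𝒰[Ξ]`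
(`fderiv_heatDuhamelBack_apply`), the identity reads
`∫ w ∂ᵥΞ = ∫ H ∂ᵥ𝒰[Ξ] - Σᵢ ∫ Fᵢ ∂ᵢ∂ᵥ𝒰[Ξ]` with `H = w(∂ₜφ + Δφ) - ⟪g, ∇φ⟫`,
`Fᵢ = φgᵢ - 2w∂ᵢφ`, and the accepted energy estimates of `HeatDuhamelEnergy`
(`energy_estimate_zero`: `∫∫ Σᵢ|∂ᵢ𝒰[Ξ]|² ≤ 2L ‖Ξ‖₂²`; `energy_estimate_one`, the maximal
regularity: `∫∫ Σᵢⱼ |∂ⱼ∂ᵢ𝒰[Ξ]|² ≤ n ‖Ξ‖₂²`) give `|∫ w ∂ᵥΞ| ≤ C ‖v‖ (‖w‖₂ + ‖g‖₂) ‖Ξ‖₂`. The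
Riesz–Fréchet theorem on the classes of test functions (`exists_memLp_two_repr_of_test_bound`,
Hahn–Banach keeps the norm) then produces the weak derivative `∂ᵥw ∈ L²` with the same bound.

## Contents

* `exists_memLp_two_repr_of_test_bound` — `(L²(O))* = L²(O)` for functionals given on the test
  functions supported in an open set `O`, with the norm bound;
* slab tools on `]a, T[ × E` (frame sums of first and second derivatives of Duhamel fields);
* `exists_top_cutoff'` — the cut-off reaching over the top, in a general Euclidean space;
* `abs_integral_mul_fderiv_test_le` — the duality bound `|∫ w ∂ᵥΞ| ≤ C ‖v‖ (‖w‖₂ + ‖g‖₂) ‖Ξ‖₂`;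
* `heatDivForm_gradient_L2_top` — the weak spatial derivatives `∂ᵥw ∈ L²` on the inner cylinder.

Cylinders are normalised to top time `0` and centre `0` (`]-L, 0[ × B(0, ρ)`); the heat equation
and all hypotheses are invariant under translations, which users perform once on their data.

## References

* O. A. Ladyzhenskaya, V. A. Solonnikov, N. N. Ural'tseva, *Linear and Quasilinear Equations of
  Parabolic Type*, AMS 1968, Ch. III §2 (energy estimates for weak solutions). [folklore]
* G. M. Lieberman, *Second Order Parabolic Differential Equations*, World Scientific 1996,
  Thm. 6.1 (interior `W^{1,2}` energy estimate). [folklore]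
* J. C. Robinson, J. L. Rodrigo, W. Sadowski, *The Three-Dimensional Navier–Stokes Equations*,
  CUP 2016, §13.3.2 (13.11)–(13.12); App. D. [`RobinsonRodrigoSadowskiCUP2016`]
* P. G. Lemarié-Rieusset, *The Navier–Stokes Problem in the 21st Century*, CRC Press 2016,
  Prop. 4.3 (B)–(C) (energy estimate and maximal regularity of the heat kernel), Thm. 13.1
  (Serrin's bootstrap). [`LemarieRieusset2016`]
-/

noncomputable section

open MeasureTheory Set Function Filter Topology TopologicalSpace Metric
open scoped NNReal ENNReal RealInnerProductSpace Laplacian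

namespace Literature.Analysis.FluidPDE

namespace HeatDivForm

/-! ### Riesz–Fréchet on the classes of test functions supported in an open set -/

section Riesz

open Literature.Analysis.FunctionSpaces

variable {X : Type*} [NormedAddCommGroup X] [NormedSpace ℝ X] [MeasurableSpace X]
  [OpensMeasurableSpace X]

omit [MeasurableSpace X] [OpensMeasurableSpace X] in
/-- Test functions on `O` are closed under addition. [folklore] -/
theorem isTestFunctionOn_add {O : Opens X} {f g : X → ℝ} (hf : IsTestFunctionOn O f)
    (hg : IsTestFunctionOn O g) : IsTestFunctionOn O (f + g) := by
  refine ⟨hf.contDiff.add hg.contDiff, hf.hasCompactSupport.add hg.hasCompactSupport, ?_⟩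
  refine (closure_minimal ?_ ((isClosed_tsupport f).union (isClosed_tsupport g))).trans
    (union_subset hf.tsupport_subset hg.tsupport_subset)
  intro x hx
  rw [Function.mem_support, Pi.add_apply] at hx
  by_contra h
  rw [mem_union, not_or] at h
  have h1 : f x = 0 := image_eq_zero_of_notMem_tsupport h.1
  have h2 : g x = 0 := image_eq_zero_of_notMem_tsupport h.2
  exact hx (by rw [h1, h2, add_zero])

omit [MeasurableSpace X] [OpensMeasurableSpace X] in
/-- Test functions on `O` are closed under scalar multiplication. [folklore] -/
theorem isTestFunctionOn_const_smul {O : Opens X} {f : X → ℝ} (hf : IsTestFunctionOn O f) (a : ℝ) :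
    IsTestFunctionOn O (a • f) := by
  refine ⟨contDiff_const.smul hf.contDiff, hf.hasCompactSupport.smul_left, ?_⟩
  exact (tsupport_smul_subset_right (fun _ : X => a) f).trans hf.tsupport_subset

/-- Two test functions on `O` which agree a.e. on `O` for a measure charging all nonempty open
sets are equal. [folklore] -/
theorem eq_of_isTestFunctionOn_of_ae_eq {μ : Measure X} [μ.IsOpenPosMeasure] {O : Opens X}
    {ψ χ : X → ℝ} (hψ : IsTestFunctionOn O ψ) (hχ : IsTestFunctionOn O χ)
    (h : ψ =ᵐ[μ.restrict (O : Set X)] χ) : ψ = χ := by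
  set D : Set X := {x | ψ x ≠ χ x} with hD
  have hDo : IsOpen D := isOpen_ne_fun hψ.contDiff.continuous hχ.contDiff.continuous
  have hDO : D ⊆ (O : Set X) := by
    intro x hx
    by_contra hxO
    have h1 : ψ x = 0 := image_eq_zero_of_notMem_tsupport fun h' => hxO (hψ.tsupport_subset h')
    have h2 : χ x = 0 := image_eq_zero_of_notMem_tsupport fun h' => hxO (hχ.tsupport_subset h')
    exact hx (by rw [h1, h2])
  have hD0 : μ.restrict (O : Set X) D = 0 := by
    rw [Filter.EventuallyEq, ae_iff] at h
    simpa [hD] using h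
  rw [Measure.restrict_apply hDo.measurableSet, inter_eq_left.2 hDO] at hD0
  have hDe : D = ∅ := by
    by_contra hne
    exact (hDo.measure_pos μ (nonempty_iff_ne_empty.2 hne)).ne' hD0
  funext x
  by_contra hx
  have : x ∈ D := hx
  rw [hDe] at this
  exact this

/-- **Riesz–Fréchet representation `(L²(O))* = L²(O)` for functionals given on test functions**
(Brezis 2011, Thm. 5.5 with Hahn–Banach, Cor. 1.2). Let `μ` be a measure on `X` finite on
compact sets and charging nonempty open sets, `O ⊆ X` open, and `Λ` a real functional on
functions `X → ℝ` which is additive and homogeneous on the test functions supported in `O` and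
satisfies `|Λ f| ≤ C ‖f‖_{L²(O)}` there, `0 ≤ C`. Then there is `G ∈ L²(O)` with
`‖G‖_{L²(O)} ≤ C` and `Λ f = ∫_O G f dμ` for every test function `f` on `O`. (The classes of
test functions form a subspace of `L²(O, μ)` on which `Λ` is a bounded linear functional — a.e.
equal test functions are equal —; extend by Hahn–Banach with the same norm and represent by
Riesz–Fréchet.) [folklore] -/
theorem exists_memLp_two_repr_of_test_bound (μ : Measure X) [IsFiniteMeasureOnCompacts μ]
    [μ.IsOpenPosMeasure] (O : Opens X) (Λ : (X → ℝ) → ℝ)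
    (hadd : ∀ f g : X → ℝ, IsTestFunctionOn O f → IsTestFunctionOn O g → Λ (f + g) = Λ f + Λ g)
    (hsmul : ∀ (a : ℝ) (f : X → ℝ), IsTestFunctionOn O f → Λ (a • f) = a * Λ f)
    {C : ℝ} (hC : 0 ≤ C)
    (hbd : ∀ f : X → ℝ, IsTestFunctionOn O f → |Λ f| ≤ C * (eLpNorm f 2 (μ.restrict O)).toReal) :
    ∃ G : X → ℝ, MemLp G 2 (μ.restrict O) ∧ eLpNorm G 2 (μ.restrict O) ≤ ENNReal.ofReal C ∧
      ∀ f : X → ℝ, IsTestFunctionOn O f → Λ f = ∫ x in (O : Set X), G x * f x ∂μ := by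
  set μ' : Measure X := μ.restrict (O : Set X) with hμ'
  have huniq : ∀ {ψ χ : X → ℝ}, IsTestFunctionOn O ψ → IsTestFunctionOn O χ →
      ψ =ᵐ[μ'] χ → ψ = χ := fun hψ hχ h => eq_of_isTestFunctionOn_of_ae_eq hψ hχ h
  -- the subspace of `L²(O)` classes of test functions
  let P : Submodule ℝ (Lp ℝ 2 μ') :=
    { carrier := {F | ∃ ψ : X → ℝ, IsTestFunctionOn O ψ ∧ (F : X → ℝ) =ᵐ[μ'] ψ}
      zero_mem' := ⟨0, isTestFunctionOn_zero _, Lp.coeFn_zero ℝ 2 μ'⟩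
      add_mem' := by
        rintro F G ⟨ψ, hψ, hF⟩ ⟨χ, hχ, hG⟩
        exact ⟨ψ + χ, isTestFunctionOn_add hψ hχ, (Lp.coeFn_add F G).trans (hF.add hG)⟩
      smul_mem' := by
        rintro a F ⟨ψ, hψ, hF⟩
        exact ⟨a • ψ, isTestFunctionOn_const_smul hψ a,
          (Lp.coeFn_smul a F).trans (hF.const_smul a)⟩ }
  have hmemP : ∀ {F : Lp ℝ 2 μ'}, F ∈ P ↔
      ∃ ψ : X → ℝ, IsTestFunctionOn O ψ ∧ (F : X → ℝ) =ᵐ[μ'] ψ := Iff.rfl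
  let rep : P → X → ℝ := fun F => Classical.choose (hmemP.1 F.2)
  have hrep : ∀ F : P, IsTestFunctionOn O (rep F) ∧ ((F : Lp ℝ 2 μ') : X → ℝ) =ᵐ[μ'] rep F :=
    fun F => Classical.choose_spec (hmemP.1 F.2)
  have hrep_add : ∀ F G : P, rep (F + G) = rep F + rep G := by
    intro F G
    refine huniq (hrep _).1 (isTestFunctionOn_add (hrep F).1 (hrep G).1) ?_
    have h1 := (hrep (F + G)).2
    rw [Submodule.coe_add] at h1
    exact h1.symm.trans ((Lp.coeFn_add (F : Lp ℝ 2 μ') (G : Lp ℝ 2 μ')).trans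
      ((hrep F).2.add (hrep G).2))
  have hrep_smul : ∀ (a : ℝ) (F : P), rep (a • F) = a • rep F := by
    intro a F
    refine huniq (hrep _).1 (isTestFunctionOn_const_smul (hrep F).1 a) ?_
    have h1 := (hrep (a • F)).2
    rw [Submodule.coe_smul] at h1
    exact h1.symm.trans ((Lp.coeFn_smul a (F : Lp ℝ 2 μ')).trans ((hrep F).2.const_smul a))
  let L₁ : P →ₗ[ℝ] ℝ :=
    { toFun := fun F => Λ (rep F)
      map_add' := fun F G => by
        show Λ (rep (F + G)) = Λ (rep F) + Λ (rep G)
        rw [hrep_add, hadd _ _ (hrep F).1 (hrep G).1]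
      map_smul' := fun a F => by
        show Λ (rep (a • F)) = a * Λ (rep F)
        rw [hrep_smul, hsmul _ _ (hrep F).1] }
  have hL₁ : ∀ F : P, L₁ F = Λ (rep F) := fun F => rfl
  have hbound : ∀ F : P, ‖L₁ F‖ ≤ C * ‖F‖ := by
    intro F
    rw [hL₁, Real.norm_eq_abs, Submodule.coe_norm, Lp.norm_def, eLpNorm_congr_ae (hrep F).2]
    exact hbd _ (hrep F).1
  let L₂ : P →L[ℝ] ℝ := L₁.mkContinuous C hbound
  have hL₂ : ∀ F : P, L₂ F = Λ (rep F) := fun F => rfl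
  have hL₂n : ‖L₂‖ ≤ C := L₁.mkContinuous_norm_le hC hbound
  obtain ⟨g, hg, hgn⟩ := exists_extension_norm_eq P L₂
  set G : Lp ℝ 2 μ' := (InnerProductSpace.toDual ℝ (Lp ℝ 2 μ')).symm g with hG
  have hGn : ‖G‖ ≤ C := by
    rw [hG, LinearIsometryEquiv.norm_map, hgn]
    exact hL₂n
  refine ⟨G, Lp.memLp G, ?_, fun f hf => ?_⟩
  · rw [← ENNReal.ofReal_toReal (Lp.eLpNorm_ne_top G), ← Lp.norm_def]
    exact ENNReal.ofReal_le_ofReal hGn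
  · have hf2 : MemLp f 2 μ' :=
      hf.contDiff.continuous.memLp_of_hasCompactSupport hf.hasCompactSupport
    have hFP : hf2.toLp f ∈ P := ⟨f, hf, hf2.coeFn_toLp⟩
    have h1 : g (hf2.toLp f) = Λ f := by
      rw [hg ⟨_, hFP⟩, hL₂]
      congr 1
      exact huniq (hrep _).1 hf ((hrep ⟨_, hFP⟩).2.symm.trans hf2.coeFn_toLp)
    have h2 : g (hf2.toLp f) = ∫ x, G x * f x ∂μ' := by
      rw [← InnerProductSpace.toDual_symm_apply (𝕜 := ℝ) (x := hf2.toLp f) (y := g), ← hG,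
        MeasureTheory.L2.inner_def]
      refine integral_congr_ae (hf2.coeFn_toLp.mono fun x hx => ?_)
      dsimp only
      rw [hx, real_inner_comm, RCLike.inner_apply, conj_trivial]
    rw [← h1, h2]

end Riesz

/-! ### Slab tools on `]a, T[ × E` -/

section Slab

variable {E : Type*} [NormedAddCommGroup E] [InnerProductSpace ℝ E] [FiniteDimensional ℝ E]
  [MeasurableSpace E] [BorelSpace E]
variable {F : Type*} [NormedAddCommGroup F] [InnerProductSpace ℝ F] [CompleteSpace F]
variable {G : Type*} [NormedAddCommGroup G] [NormedSpace ℝ G]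

/-- The slab measure `vol|_{]a,T[ × E}` is the product `vol|_{]a,T[} × vol`. [folklore] -/
theorem restrict_slab_eq_prod (a T : ℝ) :
    (volume : Measure (ℝ × E)).restrict (Ioo a T ×ˢ (univ : Set E)) =
      (volume.restrict (Ioo a T)).prod (volume : Measure E) := by
  rw [Measure.volume_eq_prod, Measure.restrict_prod_eq_prod_univ]

/-- **Swapping the slab measures**: integrals over `vol|_{]a,T[} × vol` on `ℝ × E` are integrals of
the swapped function over `vol × vol|_{]a,T]}` on `E × ℝ`. [folklore] -/
theorem integral_slab_swap' (a T : ℝ) (f : ℝ × E → G) :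
    ∫ p, f p ∂((volume.restrict (Ioo a T)).prod (volume : Measure E)) =
      ∫ q, f (q.2, q.1) ∂((volume : Measure E).prod (volume.restrict (Ioc a T))) := by
  rw [restrict_Ioo_eq_restrict_Ioc, ← integral_prod_swap]
  rfl

omit [NormedSpace ℝ G] in
/-- Integrability transfers between the two slab measures. [folklore] -/
theorem integrable_slab_of_swap' {a T : ℝ} {f : ℝ × E → G}
    (h : Integrable (fun q : E × ℝ => f (q.2, q.1)) ((volume : Measure E).prod (volume.restrict (Ioc a T)))) :
    Integrable f ((volume.restrict (Ioo a T)).prod (volume : Measure E)) := by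
  rw [restrict_Ioo_eq_restrict_Ioc]
  exact h.swap

variable {ν : ℝ}

/-- `‖𝒰[Θ]‖²` is integrable on the slab `]a,T[ × E` and its integral is `∫_{]a,T]} ∫ ‖𝒰[Θ](s)‖²`.
[folklore] -/
theorem integral_sq_norm_heatDuhamelBack_slab' {Θ : ℝ → E → F}
    (hΘ : IsSpaceTimeTestOn (⊤ : Opens (ℝ × E)) Θ) (hν : 0 < ν) (a T : ℝ) :
    Integrable (fun p : ℝ × E => ‖heatDuhamelBack ν Θ p.1 p.2‖ ^ 2)
        ((volume.restrict (Ioo a T)).prod (volume : Measure E)) ∧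
      ∫ p, ‖heatDuhamelBack ν Θ p.1 p.2‖ ^ 2 ∂((volume.restrict (Ioo a T)).prod (volume : Measure E)) =
        ∫ s in Ioc a T, ∫ x, ‖heatDuhamelBack ν Θ s x‖ ^ 2 := by
  refine ⟨integrable_slab_of_swap' (hΘ.integrable_prod_sq_norm_heatDuhamelBack hν a T), ?_⟩
  rw [integral_slab_swap', integral_prod_symm _ (hΘ.integrable_prod_sq_norm_heatDuhamelBack hν a T)]

/-- **First derivatives on the slab**: `Σᵢ ‖∂ᵢ𝒰[Θ]‖²` is integrable on `]a,T[ × E` and its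
integral is `∫ₐᵀ Σᵢ ‖∂ᵢ𝒰[Θ](s)‖₂² ds`. [folklore] -/
theorem integral_sum_sq_norm_fderiv_heatDuhamelBack_slab' {Θ : ℝ → E → F}
    (hΘ : IsSpaceTimeTestOn (⊤ : Opens (ℝ × E)) Θ) (hν : 0 < ν) {a T : ℝ} (hT : a ≤ T) :
    Integrable (fun p : ℝ × E => ∑ i, ‖fderiv ℝ (heatDuhamelBack ν Θ p.1) p.2
        (stdOrthonormalBasis ℝ E i)‖ ^ 2) ((volume.restrict (Ioo a T)).prod (volume : Measure E)) ∧
      ∫ p, ∑ i, ‖fderiv ℝ (heatDuhamelBack ν Θ p.1) p.2 (stdOrthonormalBasis ℝ E i)‖ ^ 2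
          ∂((volume.restrict (Ioo a T)).prod (volume : Measure E)) =
        ∫ s in a..T, ∑ i, ∫ x, ‖fderiv ℝ (heatDuhamelBack ν Θ s) x
          (stdOrthonormalBasis ℝ E i)‖ ^ 2 := by
  set bE := stdOrthonormalBasis ℝ E
  set μ : Measure (ℝ × E) := (volume.restrict (Ioo a T)).prod (volume : Measure E) with hμ
  have hΘi : ∀ i, IsSpaceTimeTestOn (⊤ : Opens (ℝ × E)) (fun t y => fderiv ℝ (Θ t) y (bE i)) :=
    fun i => hΘ.fderiv_apply_top (bE i)
  have hUi : ∀ i s x, fderiv ℝ (heatDuhamelBack ν Θ s) x (bE i) =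
      heatDuhamelBack ν (fun t y => fderiv ℝ (Θ t) y (bE i)) s x := fun i s x =>
    hΘ.fderiv_heatDuhamelBack_apply hν s x (bE i)
  have ii : ∀ i, Integrable (fun p : ℝ × E => ‖fderiv ℝ (heatDuhamelBack ν Θ p.1) p.2 (bE i)‖ ^ 2) μ :=
    fun i => ((integral_sq_norm_heatDuhamelBack_slab' (hΘi i) hν a T).1).congr
      (Eventually.of_forall fun p => by simp only [hUi])
  have isum : Integrable (fun p : ℝ × E => ∑ i, ‖fderiv ℝ (heatDuhamelBack ν Θ p.1) p.2 (bE i)‖ ^ 2) μ :=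
    integrable_finsetSum _ fun i _ => ii i
  refine ⟨isum, ?_⟩
  rw [integral_finsetSum _ fun i _ => ii i]
  have hI : ∀ i, ∫ p, ‖fderiv ℝ (heatDuhamelBack ν Θ p.1) p.2 (bE i)‖ ^ 2 ∂μ =
      ∫ s in Ioc a T, ∫ x, ‖fderiv ℝ (heatDuhamelBack ν Θ s) x (bE i)‖ ^ 2 := fun i => by
    have h := (integral_sq_norm_heatDuhamelBack_slab' (hΘi i) hν a T).2
    simp only [← hUi] at h
    exact h
  have hint : ∀ i, IntegrableOn (fun s => ∫ x, ‖fderiv ℝ (heatDuhamelBack ν Θ s) x (bE i)‖ ^ 2)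
      (Ioc a T) volume := fun i =>
    ((hΘi i).integrable_prod_sq_norm_heatDuhamelBack hν a T).integral_prod_right.congr
      (Eventually.of_forall fun s => by simp only [hUi])
  simp only [hI]
  rw [intervalIntegral.integral_of_le hT, integral_finsetSum _ fun i _ => hint i]

/-- **Second derivatives on the slab**: `Σᵢ Σⱼ ‖∂ⱼ∂ᵢ𝒰[Θ]‖²` is integrable on `]a,T[ × E` and its
integral is `∫ₐᵀ Σᵢ Σⱼ ‖∂ⱼ∂ᵢ𝒰[Θ](s)‖₂² ds`. [folklore] -/
theorem integral_sum_sum_sq_norm_fderiv_fderiv_heatDuhamelBack_slab' {Θ : ℝ → E → F}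
    (hΘ : IsSpaceTimeTestOn (⊤ : Opens (ℝ × E)) Θ) (hν : 0 < ν) {a T : ℝ} (hT : a ≤ T) :
    Integrable (fun p : ℝ × E => ∑ i, ∑ j, ‖fderiv ℝ (fun y => fderiv ℝ (heatDuhamelBack ν Θ p.1) y
        (stdOrthonormalBasis ℝ E i)) p.2 (stdOrthonormalBasis ℝ E j)‖ ^ 2)
        ((volume.restrict (Ioo a T)).prod (volume : Measure E)) ∧
      ∫ p, ∑ i, ∑ j, ‖fderiv ℝ (fun y => fderiv ℝ (heatDuhamelBack ν Θ p.1) y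
          (stdOrthonormalBasis ℝ E i)) p.2 (stdOrthonormalBasis ℝ E j)‖ ^ 2
          ∂((volume.restrict (Ioo a T)).prod (volume : Measure E)) =
        ∫ s in a..T, ∑ i, ∑ j, ∫ x, ‖fderiv ℝ (fun y => fderiv ℝ (heatDuhamelBack ν Θ s) y
          (stdOrthonormalBasis ℝ E i)) x (stdOrthonormalBasis ℝ E j)‖ ^ 2 := by
  set bE := stdOrthonormalBasis ℝ E
  set μ : Measure (ℝ × E) := (volume.restrict (Ioo a T)).prod (volume : Measure E) with hμ
  have hΘi : ∀ i, IsSpaceTimeTestOn (⊤ : Opens (ℝ × E)) (fun t y => fderiv ℝ (Θ t) y (bE i)) :=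
    fun i => hΘ.fderiv_apply_top (bE i)
  have hΘij : ∀ i j, IsSpaceTimeTestOn (⊤ : Opens (ℝ × E))
      (fun t y => fderiv ℝ (fun z => fderiv ℝ (Θ t) z (bE i)) y (bE j)) := fun i j =>
    (hΘi i).fderiv_apply_top (bE j)
  have hUi : ∀ i s, heatDuhamelBack ν (fun t y => fderiv ℝ (Θ t) y (bE i)) s =
      fun x => fderiv ℝ (heatDuhamelBack ν Θ s) x (bE i) := fun i s =>
    funext fun x => (hΘ.fderiv_heatDuhamelBack_apply hν s x (bE i)).symm
  have hUij : ∀ i j s x, fderiv ℝ (fun y => fderiv ℝ (heatDuhamelBack ν Θ s) y (bE i)) x (bE j) =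
      heatDuhamelBack ν (fun t y => fderiv ℝ (fun z => fderiv ℝ (Θ t) z (bE i)) y (bE j)) s x :=
    fun i j s x => by
    rw [← hUi i s]
    exact (hΘi i).fderiv_heatDuhamelBack_apply hν s x (bE j)
  have ii : ∀ i j, Integrable (fun p : ℝ × E =>
      ‖fderiv ℝ (fun y => fderiv ℝ (heatDuhamelBack ν Θ p.1) y (bE i)) p.2 (bE j)‖ ^ 2) μ := fun i j =>
    ((integral_sq_norm_heatDuhamelBack_slab' (hΘij i j) hν a T).1).congr
      (Eventually.of_forall fun p => by simp only [hUij])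
  have isum : Integrable (fun p : ℝ × E => ∑ i, ∑ j,
      ‖fderiv ℝ (fun y => fderiv ℝ (heatDuhamelBack ν Θ p.1) y (bE i)) p.2 (bE j)‖ ^ 2) μ :=
    integrable_finsetSum _ fun i _ => integrable_finsetSum _ fun j _ => ii i j
  refine ⟨isum, ?_⟩
  rw [integral_finsetSum _ fun i _ => integrable_finsetSum _ fun j _ => ii i j]
  have hI : ∀ i j, ∫ p, ‖fderiv ℝ (fun y => fderiv ℝ (heatDuhamelBack ν Θ p.1) y (bE i)) p.2 (bE j)‖ ^ 2 ∂μ =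
      ∫ s in Ioc a T, ∫ x, ‖fderiv ℝ (fun y => fderiv ℝ (heatDuhamelBack ν Θ s) y (bE i)) x (bE j)‖ ^ 2 :=
    fun i j => by
    have h := (integral_sq_norm_heatDuhamelBack_slab' (hΘij i j) hν a T).2
    simp only [← hUij] at h
    exact h
  have hint : ∀ i j, IntegrableOn (fun s => ∫ x,
      ‖fderiv ℝ (fun y => fderiv ℝ (heatDuhamelBack ν Θ s) y (bE i)) x (bE j)‖ ^ 2) (Ioc a T) volume :=
    fun i j => ((hΘij i j).integrable_prod_sq_norm_heatDuhamelBack hν a T).integral_prod_right.congr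
      (Eventually.of_forall fun s => by simp only [hUij])
  have hstep : ∀ i, ∑ j, ∫ p, ‖fderiv ℝ (fun y => fderiv ℝ (heatDuhamelBack ν Θ p.1) y (bE i)) p.2 (bE j)‖ ^ 2 ∂μ
      = ∫ s in Ioc a T, ∑ j, ∫ x, ‖fderiv ℝ (fun y => fderiv ℝ (heatDuhamelBack ν Θ s) y (bE i)) x (bE j)‖ ^ 2 :=
    fun i => by
    rw [integral_finsetSum _ fun j _ => hint i j]
    exact Finset.sum_congr rfl fun j _ => hI i j
  rw [intervalIntegral.integral_of_le hT,
    integral_finsetSum _ fun i _ => integrable_finsetSum _ fun j _ => hint i j]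
  exact Finset.sum_congr rfl fun i _ => by
    rw [integral_finsetSum _ fun j _ => ii i j]
    exact hstep i

omit [CompleteSpace F] in
/-- A space–time test field is square integrable on every slab and
`∫_{]a,T[×E} ‖Θ‖² = ∫ₐᵀ ∫ ‖Θ(s)‖²` for `a ≤ T`. [folklore] -/
theorem integral_sq_norm_slab' {Θ : ℝ → E → F}
    (hΘ : IsSpaceTimeTestOn (⊤ : Opens (ℝ × E)) Θ) {a T : ℝ} (hT : a ≤ T) :
    Integrable (fun p : ℝ × E => ‖Θ p.1 p.2‖ ^ 2) ((volume.restrict (Ioo a T)).prod (volume : Measure E)) ∧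
    ∫ p, ‖Θ p.1 p.2‖ ^ 2 ∂((volume.restrict (Ioo a T)).prod (volume : Measure E)) =
      ∫ s in a..T, ∫ x, ‖Θ s x‖ ^ 2 := by
  refine ⟨integrable_slab_of_swap' (hΘ.integrable_prod_sq_norm a T), ?_⟩
  rw [integral_slab_swap', ← hΘ.integral_prod_sq_norm_eq hT]

end Slab

/-! ### The cut-off reaching over the top, and pointwise frame bounds -/

section Cutoff

variable {E : Type*} [NormedAddCommGroup E] [InnerProductSpace ℝ E] [FiniteDimensional ℝ E]
  [MeasurableSpace E] [BorelSpace E]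

omit [MeasurableSpace E] [BorelSpace E] in
/-- **A product cut-off reaching over the top** (general Euclidean space). For `a < a' < T` and
`0 < ρ' < ρ` there is a global test field `φ = ζ(t) θ(x)` on `ℝ × E`, `0 ≤ φ ≤ 1`, with `φ = 1` on
`[a', T + 1] × B(x₀, ρ')` whose support lies in `{t ≥ (a + a')/2} × B̄(x₀, (ρ' + ρ)/2)` (product of
Mathlib bump functions). [folklore] -/
theorem exists_top_cutoff' {a a' T ρ ρ' : ℝ} (haa' : a < a') (ha'T : a' < T) (hρ' : 0 < ρ')
    (h : ρ' < ρ) (x₀ : E) :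
    ∃ φ : ℝ → E → ℝ, IsSpaceTimeTestOn (⊤ : Opens (ℝ × E)) φ ∧
      (∀ q : ℝ × E, q ∈ tsupport (uncurry φ) → (a + a') / 2 ≤ q.1 ∧ dist q.2 x₀ ≤ (ρ' + ρ) / 2) ∧
      (∀ q : ℝ × E, q.1 ∈ Icc a' (T + 1) → q.2 ∈ ball x₀ ρ' → φ q.1 q.2 = 1) ∧
      ∀ t x, 0 ≤ φ t x ∧ φ t x ≤ 1 := by
  let ζ : ContDiffBump ((a' + (T + 1)) / 2 : ℝ) :=
    ⟨(T + 1 - a') / 2, (T + 1 - a') / 2 + (a' - a) / 2, by linarith, by linarith⟩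
  let θ : ContDiffBump x₀ := ⟨ρ', (ρ' + ρ) / 2, hρ', by linarith⟩
  have hζout : ζ.rOut = (T + 1 - a') / 2 + (a' - a) / 2 := rfl
  have hθout : θ.rOut = (ρ' + ρ) / 2 := rfl
  have hsub : Function.support (uncurry fun t x => ζ t * θ x) ⊆
      closedBall ((a' + (T + 1)) / 2) ζ.rOut ×ˢ closedBall x₀ θ.rOut := by
    intro q hq
    rw [Function.mem_support] at hq
    simp only [uncurry] at hq
    have h1 : ζ q.1 ≠ 0 := left_ne_zero_of_mul hq
    have h2 : θ q.2 ≠ 0 := right_ne_zero_of_mul hq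
    have h1' : q.1 ∈ Function.support (ζ : ℝ → ℝ) := h1
    have h2' : q.2 ∈ Function.support (θ : E → ℝ) := h2
    rw [ζ.support_eq] at h1'
    rw [θ.support_eq] at h2'
    exact ⟨ball_subset_closedBall h1', ball_subset_closedBall h2'⟩
  have htsupp : tsupport (uncurry fun t x => ζ t * θ x) ⊆
      closedBall ((a' + (T + 1)) / 2) ζ.rOut ×ˢ closedBall x₀ θ.rOut :=
    closure_minimal hsub ((isClosed_closedBall).prod isClosed_closedBall)
  refine ⟨fun t x => ζ t * θ x, ⟨?_, ?_, fun _ _ => trivial⟩, ?_, ?_, ?_⟩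
  · exact (ζ.contDiff.comp contDiff_fst).mul (θ.contDiff.comp contDiff_snd)
  · exact HasCompactSupport.intro' ((isCompact_closedBall _ ζ.rOut).prod
      (isCompact_closedBall x₀ θ.rOut)) ((isClosed_closedBall).prod isClosed_closedBall)
      fun q hq => by
        by_contra hne
        exact hq (hsub (Function.mem_support.2 hne))
  · intro q hq
    obtain ⟨h1, h2⟩ := htsupp hq
    rw [mem_closedBall, Real.dist_eq, hζout] at h1
    rw [mem_closedBall, hθout] at h2
    refine ⟨?_, h2⟩
    have := (abs_le.1 h1).1
    linarith
  · rintro ⟨t, x⟩ ht hx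
    simp only at ht hx
    have h1 : ζ t = 1 := ζ.one_of_mem_closedBall (by
      rw [mem_closedBall, Real.dist_eq]
      change |t - (a' + (T + 1)) / 2| ≤ (T + 1 - a') / 2
      rw [abs_le]
      constructor <;> linarith [ht.1, ht.2])
    have h2 : θ x = 1 := θ.one_of_mem_closedBall (by
      rw [mem_closedBall]
      exact (mem_ball.1 hx).le)
    simp [h1, h2]
  · intro t x
    exact ⟨mul_nonneg (ζ.nonneg) (θ.nonneg), mul_le_one₀ ζ.le_one θ.nonneg θ.le_one⟩

omit [MeasurableSpace E] [BorelSpace E] in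
/-- `‖Df(x) v‖² ≤ ‖v‖² Σᵢ ‖Df(x) bᵢ‖²` in the standard frame. [folklore] -/
theorem norm_fderiv_apply_sq_le {G : Type*} [NormedAddCommGroup G] [NormedSpace ℝ G]
    (f : E → G) (x v : E) :
    ‖fderiv ℝ f x v‖ ^ 2 ≤ ‖v‖ ^ 2 * ∑ i, ‖fderiv ℝ f x (stdOrthonormalBasis ℝ E i)‖ ^ 2 := by
  have h1 : ‖fderiv ℝ f x v‖ ≤ ‖fderiv ℝ f x‖ * ‖v‖ := ContinuousLinearMap.le_opNorm _ _
  have h2 := opNorm_le_sqrt_sum_sq (stdOrthonormalBasis ℝ E) (fderiv ℝ f x)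
  have h0 : 0 ≤ ∑ i, ‖fderiv ℝ f x (stdOrthonormalBasis ℝ E i)‖ ^ 2 :=
    Finset.sum_nonneg fun _ _ => by positivity
  calc ‖fderiv ℝ f x v‖ ^ 2 ≤ (‖fderiv ℝ f x‖ * ‖v‖) ^ 2 := by gcongr
    _ ≤ (Real.sqrt (∑ i, ‖fderiv ℝ f x (stdOrthonormalBasis ℝ E i)‖ ^ 2) * ‖v‖) ^ 2 := by gcongr
    _ = ‖v‖ ^ 2 * ∑ i, ‖fderiv ℝ f x (stdOrthonormalBasis ℝ E i)‖ ^ 2 := by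
        rw [mul_pow, Real.sq_sqrt h0, mul_comm]

omit [MeasurableSpace E] [BorelSpace E] in
/-- `‖∂_w ∂_v f(x)‖² ≤ ‖v‖² ‖w‖² Σᵢⱼ ‖∂ⱼ∂ᵢ f(x)‖²` for a scalar `C²` function, in the standard frame
(the mixed derivative is `D²f(x)(w)(v)`). [folklore] -/
theorem norm_fderiv_fderiv_apply_sq_le {f : E → ℝ} {x : E} (hf : DifferentiableAt ℝ (fderiv ℝ f) x)
    (v w : E) :
    ‖fderiv ℝ (fun y => fderiv ℝ f y v) x w‖ ^ 2 ≤ ‖v‖ ^ 2 * ‖w‖ ^ 2 * ∑ i, ∑ j,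
      ‖fderiv ℝ (fun y => fderiv ℝ f y (stdOrthonormalBasis ℝ E i)) x (stdOrthonormalBasis ℝ E j)‖ ^ 2 := by
  have he : fderiv ℝ (fun y => fderiv ℝ f y v) x w = fderiv ℝ (fderiv ℝ f) x w v := by
    rw [fderiv_clm_apply hf (differentiableAt_const _)]
    simp
  rw [he]
  have h1 : ‖fderiv ℝ (fderiv ℝ f) x w v‖ ≤ ‖fderiv ℝ (fderiv ℝ f) x‖ * ‖w‖ * ‖v‖ :=
    (ContinuousLinearMap.le_opNorm _ _).trans
      (mul_le_mul_of_nonneg_right (ContinuousLinearMap.le_opNorm _ _) (norm_nonneg _))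
  have h2 := norm_fderiv_fderiv_sq_le_sum_sum (g := f) x
  have h0 : 0 ≤ ∑ i, ∑ j, ‖fderiv ℝ (fun y => fderiv ℝ f y (stdOrthonormalBasis ℝ E i)) x
      (stdOrthonormalBasis ℝ E j)‖ ^ 2 :=
    Finset.sum_nonneg fun _ _ => Finset.sum_nonneg fun _ _ => by positivity
  calc ‖fderiv ℝ (fderiv ℝ f) x w v‖ ^ 2 ≤ (‖fderiv ℝ (fderiv ℝ f) x‖ * ‖w‖ * ‖v‖) ^ 2 := by gcongr
    _ = ‖v‖ ^ 2 * ‖w‖ ^ 2 * ‖fderiv ℝ (fderiv ℝ f) x‖ ^ 2 := by ring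
    _ ≤ ‖v‖ ^ 2 * ‖w‖ ^ 2 * ∑ i, ∑ j, ‖fderiv ℝ (fun y => fderiv ℝ f y (stdOrthonormalBasis ℝ E i)) x
      (stdOrthonormalBasis ℝ E j)‖ ^ 2 := by gcongr

end Cutoff

/-! ### `L²` bookkeeping: the localised data, square roots, pairings on a slab -/

section Bookkeeping

variable {E : Type*} [NormedAddCommGroup E] [InnerProductSpace ℝ E] [FiniteDimensional ℝ E]
  [MeasurableSpace E] [BorelSpace E]
variable {ι : Type*} [Fintype ι]

/-- `(eLpNorm f 2 μ).toReal = √(∫ ‖f‖²)` for `f ∈ L²`. [folklore] -/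
theorem toReal_eLpNorm_two_eq_sqrt {α G : Type*} [MeasurableSpace α] {μ : Measure α}
    [NormedAddCommGroup G] {f : α → G} (hf : MemLp f 2 μ) :
    (eLpNorm f 2 μ).toReal = Real.sqrt (∫ x, ‖f x‖ ^ 2 ∂μ) := by
  rw [hf.eLpNorm_eq_integral_rpow_norm two_ne_zero ENNReal.ofNat_ne_top, ENNReal.toReal_ofNat,
    ENNReal.toReal_ofReal (Real.rpow_nonneg (integral_nonneg fun _ => by positivity) _),
    Real.sqrt_eq_rpow]
  congr 1
  · refine integral_congr_ae (Eventually.of_forall fun x => ?_)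
    simp only [Real.rpow_two]
  · norm_num

/-- A pointwise bound `‖f‖ ≤ c ‖g‖`, `0 ≤ c`, gives `‖f‖₂ ≤ c ‖g‖₂`. [folklore] -/
theorem eLpNorm_le_ofReal_mul_of_le {α G H : Type*} [MeasurableSpace α] {μ : Measure α}
    [NormedAddCommGroup G] [NormedAddCommGroup H] {f : α → G} {g : α → H} {c : ℝ} (hc : 0 ≤ c)
    (h : ∀ x, ‖f x‖ ≤ c * ‖g x‖) (p : ℝ≥0∞) :
    eLpNorm f p μ ≤ ENNReal.ofReal c * eLpNorm g p μ := by
  have h1 : eLpNorm f p μ ≤ eLpNorm (fun x => c * ‖g x‖) p μ :=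
    eLpNorm_mono_real fun x => h x
  refine h1.trans (le_of_eq ?_)
  have h2 : (fun x => c * ‖g x‖) = c • fun x => ‖g x‖ := by funext x; simp
  rw [h2, eLpNorm_const_smul, Real.enorm_eq_ofReal hc, eLpNorm_norm]

omit [MeasurableSpace E] [BorelSpace E] [FiniteDimensional ℝ E] in
/-- Coordinates in a frame are bounded by the norm: `Σᵢ |⟪g, bᵢ⟫| |cᵢ| ≤ (card ι) K ‖g‖` when
`|cᵢ| ≤ K`. [folklore] -/
theorem sum_abs_inner_mul_le (b : OrthonormalBasis ι ℝ E) (g : E) {c : ι → ℝ} {K : ℝ}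
    (hK : ∀ i, |c i| ≤ K) : ∑ i, |⟪g, b i⟫ * c i| ≤ (Fintype.card ι : ℝ) * K * ‖g‖ := by
  calc ∑ i, |⟪g, b i⟫ * c i| = ∑ i, |⟪g, b i⟫| * |c i| := Finset.sum_congr rfl fun i _ => abs_mul _ _
    _ ≤ ∑ _i : ι, ‖g‖ * K := Finset.sum_le_sum fun i _ => by
        refine mul_le_mul ?_ (hK i) (abs_nonneg _) (norm_nonneg _)
        calc |⟪g, b i⟫| ≤ ‖g‖ * ‖b i‖ := abs_real_inner_le_norm _ _
          _ = ‖g‖ := by rw [b.orthonormal.1 i, mul_one]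
    _ = (Fintype.card ι : ℝ) * K * ‖g‖ := by
        rw [Finset.sum_const, Finset.card_univ, nsmul_eq_mul]; ring

/-- **`L²` bound for the scalar localised datum**:
`‖locH‖₂ ≤ (Kₜ + K_Δ) ‖w‖₂ + (card ι) K_D ‖g‖₂` when `|∂ₜφ| ≤ Kₜ`, `|Δφ| ≤ K_Δ`, `|∂ᵢφ| ≤ K_D`.
[folklore] -/
theorem eLpNorm_locH_le (b : OrthonormalBasis ι ℝ E) {φ : ℝ → E → ℝ}
    (hφ : IsSpaceTimeTestOn (⊤ : Opens (ℝ × E)) φ) {w : ℝ × E → ℝ} {g : ℝ × E → E}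
    (hw : MemLp w 2 (volume : Measure (ℝ × E))) (hg : MemLp g 2 (volume : Measure (ℝ × E)))
    {Kt Kl Kg : ℝ} (hKt0 : 0 ≤ Kt) (hKl0 : 0 ≤ Kl) (hKg0 : 0 ≤ Kg)
    (hKt : ∀ t x, ‖timeDeriv φ t x‖ ≤ Kt) (hKl : ∀ t x, ‖(Δ (φ t)) x‖ ≤ Kl)
    (hKg : ∀ t x i, ‖fderiv ℝ (φ t) x (b i)‖ ≤ Kg) :
    eLpNorm (locH b φ w g) 2 (volume : Measure (ℝ × E)) ≤
      ENNReal.ofReal (Kt + Kl) * eLpNorm w 2 (volume : Measure (ℝ × E)) +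
        ENNReal.ofReal ((Fintype.card ι : ℝ) * Kg) * eLpNorm g 2 (volume : Measure (ℝ × E)) := by
  set A : ℝ × E → ℝ := fun q => w q * (timeDeriv φ q.1 q.2 + (Δ (φ q.1)) q.2) with hA
  set B : ℝ × E → ℝ := fun q => ∑ i, ⟪g q, b i⟫ * fderiv ℝ (φ q.1) q.2 (b i) with hB
  have hHeq : locH b φ w g = A - B := by funext q; simp [locH, hA, hB]
  have hφs : ContDiff ℝ ((⊤ : ℕ∞) : WithTop ℕ∞) (uncurry φ) := hφ.contDiff
  have cχ : Continuous fun q : ℝ × E => timeDeriv φ q.1 q.2 + (Δ (φ q.1)) q.2 :=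
    (continuous_timeDeriv_of_contDiff hφs).add (continuous_laplacian_slice_of_contDiff hφs)
  have cdφ : ∀ i, Continuous fun q : ℝ × E => fderiv ℝ (φ q.1) q.2 (b i) := fun i =>
    continuous_fderiv_slice_apply_of_contDiff hφs (b i)
  have hAm : AEStronglyMeasurable A volume := hw.1.mul cχ.aestronglyMeasurable
  have hBm : AEStronglyMeasurable B volume :=
    Finset.aestronglyMeasurable_fun_sum _ fun i _ => (hg.1.inner aestronglyMeasurable_const).mul
      (cdφ i).aestronglyMeasurable
  have hA2 : eLpNorm A 2 volume ≤ ENNReal.ofReal (Kt + Kl) * eLpNorm w 2 volume := by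
    refine eLpNorm_le_ofReal_mul_of_le (by positivity) (fun q => ?_) 2
    rw [hA, norm_mul, mul_comm]
    refine mul_le_mul_of_nonneg_right ?_ (norm_nonneg _)
    exact (norm_add_le _ _).trans (add_le_add (hKt q.1 q.2) (hKl q.1 q.2))
  have hB2 : eLpNorm B 2 volume ≤ ENNReal.ofReal ((Fintype.card ι : ℝ) * Kg) * eLpNorm g 2 volume := by
    refine eLpNorm_le_ofReal_mul_of_le (by positivity) (fun q => ?_) 2
    rw [hB, Real.norm_eq_abs]
    refine (Finset.abs_sum_le_sum_abs _ _).trans ?_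
    exact sum_abs_inner_mul_le b (g q) (c := fun i => fderiv ℝ (φ q.1) q.2 (b i)) (K := Kg)
      fun i => by simpa [Real.norm_eq_abs] using hKg q.1 q.2 i
  rw [hHeq]
  exact (eLpNorm_sub_le hAm hBm one_le_two).trans (add_le_add hA2 hB2)

/-- **`L²` bound for the vector localised data**: `‖locFᵢ‖₂ ≤ K₀ ‖g‖₂ + 2 K_D ‖w‖₂` when
`|φ| ≤ K₀`, `|∂ᵢφ| ≤ K_D`. [folklore] -/
theorem eLpNorm_locF_le (b : OrthonormalBasis ι ℝ E) {φ : ℝ → E → ℝ}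
    (hφ : IsSpaceTimeTestOn (⊤ : Opens (ℝ × E)) φ) {w : ℝ × E → ℝ} {g : ℝ × E → E}
    (hw : MemLp w 2 (volume : Measure (ℝ × E))) (hg : MemLp g 2 (volume : Measure (ℝ × E)))
    {K₀ Kg : ℝ} (hK₀0 : 0 ≤ K₀) (hKg0 : 0 ≤ Kg) (hK₀ : ∀ t x, ‖φ t x‖ ≤ K₀)
    (hKg : ∀ t x i, ‖fderiv ℝ (φ t) x (b i)‖ ≤ Kg) (i : ι) :
    eLpNorm (locF b φ w g i) 2 (volume : Measure (ℝ × E)) ≤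
      ENNReal.ofReal K₀ * eLpNorm g 2 (volume : Measure (ℝ × E)) +
        ENNReal.ofReal (2 * Kg) * eLpNorm w 2 (volume : Measure (ℝ × E)) := by
  set A : ℝ × E → ℝ := fun q => φ q.1 q.2 * ⟪g q, b i⟫ with hA
  set B : ℝ × E → ℝ := fun q => 2 * w q * fderiv ℝ (φ q.1) q.2 (b i) with hB
  have hFeq : locF b φ w g i = A - B := by funext q; simp [locF, hA, hB]
  have hφs : ContDiff ℝ ((⊤ : ℕ∞) : WithTop ℕ∞) (uncurry φ) := hφ.contDiff
  have cφ : Continuous fun q : ℝ × E => φ q.1 q.2 := hφs.continuous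
  have cdφ : Continuous fun q : ℝ × E => fderiv ℝ (φ q.1) q.2 (b i) :=
    continuous_fderiv_slice_apply_of_contDiff hφs (b i)
  have hAm : AEStronglyMeasurable A volume :=
    cφ.aestronglyMeasurable.mul (hg.1.inner aestronglyMeasurable_const)
  have hBm : AEStronglyMeasurable B volume :=
    ((hw.1.const_mul 2).mul cdφ.aestronglyMeasurable)
  have hA2 : eLpNorm A 2 volume ≤ ENNReal.ofReal K₀ * eLpNorm g 2 volume := by
    refine eLpNorm_le_ofReal_mul_of_le hK₀0 (fun q => ?_) 2
    rw [hA, norm_mul]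
    refine mul_le_mul (hK₀ q.1 q.2) ?_ (norm_nonneg _) hK₀0
    calc ‖⟪g q, b i⟫‖ ≤ ‖g q‖ * ‖b i‖ := norm_inner_le_norm _ _
      _ = ‖g q‖ := by rw [b.orthonormal.1 i, mul_one]
  have hB2 : eLpNorm B 2 volume ≤ ENNReal.ofReal (2 * Kg) * eLpNorm w 2 volume := by
    refine eLpNorm_le_ofReal_mul_of_le (by positivity) (fun q => ?_) 2
    rw [hB, norm_mul, norm_mul, Real.norm_two]
    calc 2 * ‖w q‖ * ‖fderiv ℝ (φ q.1) q.2 (b i)‖ ≤ 2 * ‖w q‖ * Kg := by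
          gcongr; exact hKg q.1 q.2 i
      _ = 2 * Kg * ‖w q‖ := by ring
  rw [hFeq]
  exact (eLpNorm_sub_le hAm hBm one_le_two).trans (add_le_add hA2 hB2)

/-- **Cauchy–Schwarz for a pairing living on a slab.** If `P ∈ L²(ℝ × E)`, `D` is continuous with
`‖D‖²` integrable on the slab `]a, T[ × E`, and the product `P · D` vanishes off the slab, then
`|∫ P D| ≤ ‖P‖₂ √(∫_{slab} ‖D‖²)`. [folklore] -/
theorem abs_integral_mul_le_of_slab {a T : ℝ} {P D : ℝ × E → ℝ}
    (hP : MemLp P 2 (volume : Measure (ℝ × E))) (hD : Continuous D)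
    (hD2 : Integrable (fun q => ‖D q‖ ^ 2) ((volume.restrict (Ioo a T)).prod (volume : Measure E)))
    (h0 : ∀ q : ℝ × E, q.1 ∉ Ioo a T → P q * D q = 0) :
    |∫ q, P q * D q| ≤ (eLpNorm P 2 (volume : Measure (ℝ × E))).toReal *
      Real.sqrt (∫ q, ‖D q‖ ^ 2 ∂((volume.restrict (Ioo a T)).prod (volume : Measure E))) := by
  set S : Set (ℝ × E) := Ioo a T ×ˢ (univ : Set E) with hS
  set μS : Measure (ℝ × E) := (volume.restrict (Ioo a T)).prod (volume : Measure E) with hμS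
  have hμS : (volume : Measure (ℝ × E)).restrict S = μS := restrict_slab_eq_prod a T
  have h1 : ∫ q, P q * D q = ∫ q in S, P q * D q := by
    refine (setIntegral_eq_integral_of_forall_compl_eq_zero fun q hq => h0 q ?_).symm
    exact fun h => hq ⟨h, mem_univ _⟩
  rw [h1, hμS]
  have hPS : MemLp P 2 μS := by rw [← hμS]; exact hP.restrict S
  have hDS : MemLp D 2 μS := (memLp_two_iff_integrable_sq_norm hD.aestronglyMeasurable).2 hD2
  have h2 : |∫ q, P q * D q ∂μS| ≤ ∫ q, ‖P q‖ * ‖D q‖ ∂μS := by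
    refine (abs_integral_le_integral_abs).trans (le_of_eq (integral_congr_ae
      (Eventually.of_forall fun q => ?_)))
    simp only [abs_mul, Real.norm_eq_abs]
  refine h2.trans ((integral_norm_mul_norm_le_sqrt_mul_sqrt hPS hDS).trans ?_)
  rw [← toReal_eLpNorm_two_eq_sqrt hPS]
  refine mul_le_mul_of_nonneg_right ?_ (Real.sqrt_nonneg _)
  refine ENNReal.toReal_mono hP.eLpNorm_ne_top ?_
  rw [← hμS]
  exact eLpNorm_restrict_le _ _ _ _

end Bookkeeping

/-! ### The duality bound and the `L²` gradient -/

section GradientL2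

variable {E : Type*} [NormedAddCommGroup E] [InnerProductSpace ℝ E] [FiniteDimensional ℝ E]
  [MeasurableSpace E] [BorelSpace E]

omit [MeasurableSpace E] [BorelSpace E] [FiniteDimensional ℝ E] [InnerProductSpace ℝ E] in
/-- If `ψ t = 0` then every directional slice derivative of `ψ t` vanishes. [folklore] -/
theorem fderiv_apply_slice_eq_zero_of_eq_zero [NormedSpace ℝ E] {ψ : ℝ → E → ℝ} {t : ℝ}
    (h : ψ t = 0) (v : E) : (fun x => fderiv ℝ (ψ t) x v) = 0 := by
  funext x
  rw [h]
  simp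

set_option maxHeartbeats 800000 in
/-- **The duality bound** (module docstring): on the normalised cylinder
`Q = ]-L, 0[ × B(0, ρ)`, a distributional solution `w ∈ L²(Q)` of `∂ₜw - Δw = div g`,
`g ∈ L²(Q)`, satisfies, for every direction `v` and every test function `Ξ` supported in the
inner cylinder `Q' = ]-L', 0[ × B(0, ρ')`,
`|∫ w ∂ᵥΞ| ≤ C ‖v‖ (‖w‖_{L²(Q)} + ‖g‖_{L²(Q)}) ‖Ξ‖_{L²}`, with `C = C(L, L', ρ, ρ', dim E)` fixed
before the solution. [folklore] -/
theorem abs_integral_mul_fderiv_test_le {L L' ρ ρ' : ℝ} (hL' : 0 < L') (hL : L' < L)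
    (hρ' : 0 < ρ') (hρ : ρ' < ρ) :
    ∃ C : ℝ, 0 ≤ C ∧ ∀ (w : ℝ × E → ℝ) (g : ℝ × E → E),
      MemLp w 2 (volume.restrict (Ioo (-L) 0 ×ˢ ball (0 : E) ρ)) →
      MemLp g 2 (volume.restrict (Ioo (-L) 0 ×ˢ ball (0 : E) ρ)) →
      (∀ ψ : ℝ → E → ℝ,
        IsSpaceTimeTestOn (⟨Ioo (-L) 0 ×ˢ ball (0 : E) ρ, isOpen_Ioo.prod isOpen_ball⟩ :
          Opens (ℝ × E)) ψ →
        ∫ q : ℝ × E, w q * (timeDeriv ψ q.1 q.2 + (Δ (ψ q.1)) q.2) =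
          ∫ q : ℝ × E, ⟪g q, gradient (ψ q.1) q.2⟫) →
      ∀ (v : E) (Ξ : ℝ → E → ℝ),
        IsSpaceTimeTestOn (⟨Ioo (-L') 0 ×ˢ ball (0 : E) ρ', isOpen_Ioo.prod isOpen_ball⟩ :
          Opens (ℝ × E)) Ξ →
        |∫ q : ℝ × E, w q * fderiv ℝ (Ξ q.1) q.2 v| ≤
          C * ‖v‖ * ((eLpNorm w 2 (volume.restrict (Ioo (-L) 0 ×ˢ ball (0 : E) ρ))).toReal +
            (eLpNorm g 2 (volume.restrict (Ioo (-L) 0 ×ˢ ball (0 : E) ρ))).toReal) *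
          Real.sqrt (∫ q : ℝ × E, ‖Ξ q.1 q.2‖ ^ 2) := by
  -- the cut-off and its sup bounds
  obtain ⟨φ, hφ, hφsupp, hφ1, hφ01⟩ :=
    exists_top_cutoff' (E := E) (a := -L) (a' := -L') (T := 0) (by linarith) (by linarith) hρ' hρ 0
  set bs := stdOrthonormalBasis ℝ E with hbs
  obtain ⟨Kt, hKt0, hKt⟩ := hφ.timeDeriv_top.exists_norm_le
  obtain ⟨Kl, hKl0, hKl⟩ := hφ.laplacian_top.exists_norm_le
  obtain ⟨Kg, hKg0, hKg⟩ := hφ.fderiv_top.exists_norm_le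
  have hKgi : ∀ t x i, ‖fderiv ℝ (φ t) x (bs i)‖ ≤ Kg := fun t x i =>
    (ContinuousLinearMap.le_opNorm _ _).trans (by rw [bs.orthonormal.1 i, mul_one]; exact hKg t x)
  have hK₀ : ∀ t x, ‖φ t x‖ ≤ 1 := fun t x => by
    rw [Real.norm_eq_abs, abs_le]; exact ⟨by linarith [(hφ01 t x).1], (hφ01 t x).2⟩
  set n : ℝ := (Fintype.card (Fin (Module.finrank ℝ E)) : ℝ) with hn
  have hn0 : 0 ≤ n := Nat.cast_nonneg _
  have hnE : (Module.finrank ℝ E : ℝ) = n := by rw [hn, Fintype.card_fin]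
  set C : ℝ := Real.sqrt (2 * L) * (Kt + Kl + n * Kg) + n * Real.sqrt n * (1 + 2 * Kg) with hC
  have hC0 : 0 ≤ C := by positivity
  refine ⟨C, hC0, fun w g hw hg heq v Ξ hΞ => ?_⟩
  -- names
  set Qs : Set (ℝ × E) := Ioo (-L) 0 ×ˢ ball (0 : E) ρ with hQs
  set Qo : Opens (ℝ × E) := ⟨Qs, isOpen_Ioo.prod isOpen_ball⟩ with hQo
  set Qs' : Set (ℝ × E) := Ioo (-L') 0 ×ˢ ball (0 : E) ρ' with hQs'
  have hQmeas : MeasurableSet Qs := (isOpen_Ioo.prod isOpen_ball).measurableSet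
  have hQ'Q : Qs' ⊆ Qs := prod_mono (Ioo_subset_Ioo (by linarith) le_rfl) (ball_subset_ball hρ.le)
  -- Step A: extension by zero
  set w' : ℝ × E → ℝ := Qs.indicator w with hw'
  set g' : ℝ × E → E := Qs.indicator g with hg'
  have hw'm : MemLp w' 2 (volume : Measure (ℝ × E)) := (memLp_indicator_iff_restrict hQmeas).2 hw
  have hg'm : MemLp g' 2 (volume : Measure (ℝ × E)) := (memLp_indicator_iff_restrict hQmeas).2 hg
  have hQfin : volume Qs < ⊤ := by
    rw [hQs, Measure.volume_eq_prod, Measure.prod_prod]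
    exact ENNReal.mul_lt_top (by simp [Real.volume_Ioo]) measure_ball_lt_top
  haveI : IsFiniteMeasure ((volume : Measure (ℝ × E)).restrict Qs) := isFiniteMeasure_restrict.2 hQfin.ne
  have hw'i : Integrable w' (volume : Measure (ℝ × E)) :=
    IntegrableOn.integrable_indicator (hw.integrable one_le_two) hQmeas
  have hg'i : Integrable g' (volume : Measure (ℝ × E)) :=
    IntegrableOn.integrable_indicator (hg.integrable one_le_two) hQmeas
  have hNw : eLpNorm w' 2 (volume : Measure (ℝ × E)) = eLpNorm w 2 (volume.restrict Qs) :=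
    eLpNorm_indicator_eq_eLpNorm_restrict hQmeas
  have hNg : eLpNorm g' 2 (volume : Measure (ℝ × E)) = eLpNorm g 2 (volume.restrict Qs) :=
    eLpNorm_indicator_eq_eLpNorm_restrict hQmeas
  have heq' : ∀ ψ : ℝ → E → ℝ, IsSpaceTimeTestOn Qo ψ →
      ∫ q : ℝ × E, w' q * (timeDeriv ψ q.1 q.2 + (Δ (ψ q.1)) q.2) =
        ∫ q : ℝ × E, ⟪g' q, gradient (ψ q.1) q.2⟫ := by
    intro ψ hψ
    have e1 : (fun q : ℝ × E => w' q * (timeDeriv ψ q.1 q.2 + (Δ (ψ q.1)) q.2)) =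
        fun q => w q * (timeDeriv ψ q.1 q.2 + (Δ (ψ q.1)) q.2) := by
      funext q
      by_cases hq : q ∈ Qs
      · rw [hw', indicator_of_mem hq]
      · have hq' : q ∉ tsupport (uncurry ψ) := fun h => hq (hψ.tsupport_subset h)
        rw [IsSpaceTimeTestOn.timeDeriv_eq_zero_of_notMem (ψ := ψ) (t := q.1) (x := q.2) hq',
          laplacian_slice_eq_zero_of_notMem_tsupport (ψ := ψ) (t := q.1) (x := q.2) hq']
        simp
    have e2 : (fun q : ℝ × E => ⟪g' q, gradient (ψ q.1) q.2⟫) = fun q => ⟪g q, gradient (ψ q.1) q.2⟫ := by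
      funext q
      by_cases hq : q ∈ Qs
      · rw [hg', indicator_of_mem hq]
      · have hq' : q ∉ tsupport (uncurry ψ) := fun h => hq (hψ.tsupport_subset h)
        rw [hψ.continuous_gradient_field.2.2 q hq']
        simp
    rw [e1, e2]
    exact heq ψ hψ
  -- Step B: the test function `Θ = ∂ᵥΞ`, its Duhamel field, and the test property of `φ 𝒰[Θ]`
  have hΞtop : IsSpaceTimeTestOn (⊤ : Opens (ℝ × E)) Ξ := hΞ.mono le_top
  set Θ : ℝ → E → ℝ := fun t x => fderiv ℝ (Ξ t) x v with hΘ
  have hΘt : IsSpaceTimeTestOn (⊤ : Opens (ℝ × E)) Θ := hΞtop.fderiv_apply_top v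
  obtain ⟨a₀, b₀, -, hb₀, hab₀⟩ := exists_time_support_lt_top (E := E) (T := 0) (ψ := Ξ)
    hΞ.hasCompactSupport (fun q hq => (hΞ.tsupport_subset hq).1.2)
  have habΘ : ∀ t, t ∉ Icc a₀ b₀ → Θ t = 0 := fun t ht =>
    fderiv_apply_slice_eq_zero_of_eq_zero (hab₀ t ht) v
  set UΞ : ℝ → E → ℝ := heatDuhamelBack 1 Ξ with hUΞ
  set U : ℝ → E → ℝ := heatDuhamelBack 1 Θ with hU
  have hUeq : ∀ s x, U s x = fderiv ℝ (UΞ s) x v := fun s x =>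
    (hΞtop.fderiv_heatDuhamelBack_apply one_pos s x v).symm
  have hUfun : ∀ s, U s = fun x => fderiv ℝ (UΞ s) x v := fun s => funext (hUeq s)
  have hU0 : ∀ s, b₀ ≤ s → ∀ x, U s x = 0 := fun s hs x =>
    hΘt.heatDuhamelBack_eq_zero_of_le one_pos habΘ hs x
  have hψ : IsSpaceTimeTestOn Qo (fun t x => φ t x * U t x) := by
    refine isSpaceTimeTestOn_mul_of_eq_zero_of_le hφ
      (hΘt.contDiff_uncurry_heatDuhamelBack_infty one_pos) hU0 fun q hq hqb => ?_
    obtain ⟨hq1, hq2⟩ := hφsupp q hq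
    change q ∈ Ioo (-L) 0 ×ˢ ball (0 : E) ρ
    refine ⟨⟨by linarith, by linarith⟩, ?_⟩
    rw [mem_ball]
    linarith
  have key := integral_cutoff_mul_mul_test_eq_of_test bs hw'i hg'i heq' hφ hΘt hψ
  rw [← hU] at key
  -- Step C: the left-hand side is `∫ w ∂ᵥΞ`
  have hLHS : ∫ q : ℝ × E, φ q.1 q.2 * w' q * Θ q.1 q.2 = ∫ q : ℝ × E, w q * fderiv ℝ (Ξ q.1) q.2 v := by
    refine integral_congr_ae (Eventually.of_forall fun q => ?_)
    simp only [hΘ]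
    by_cases hq : q ∈ tsupport (uncurry Ξ)
    · have hqQ' : q ∈ Qs' := hΞ.tsupport_subset hq
      have hφq : φ q.1 q.2 = 1 := hφ1 q ⟨hqQ'.1.1.le, by linarith [hqQ'.1.2]⟩ hqQ'.2
      rw [hφq, hw', indicator_of_mem (hQ'Q hqQ'), one_mul]
    · rw [IsSpaceTimeTestOn.fderiv_slice_eq_zero_of_notMem (ψ := Ξ) (t := q.1) (x := q.2) hq]
      simp
  -- Step D: slab integrability of the Duhamel fields and the energy estimates for `Ξ`
  set μS : Measure (ℝ × E) := (volume.restrict (Ioo (-L) 0)).prod (volume : Measure E) with hμS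
  have hL0 : (-L : ℝ) ≤ 0 := by linarith
  obtain ⟨hI1, hE1⟩ := integral_sum_sq_norm_fderiv_heatDuhamelBack_slab' hΞtop one_pos hL0
  obtain ⟨hI2, hE2⟩ := integral_sum_sum_sq_norm_fderiv_fderiv_heatDuhamelBack_slab' hΞtop one_pos hL0
  obtain ⟨hIΞ, hEΞ⟩ := integral_sq_norm_slab' hΞtop hL0
  have hen0 := (hΞtop.energy_estimate_zero one_pos hab₀ (τ₀ := -L) (T := 0) hL0 hb₀.le).2
  have hen1 := hΞtop.energy_estimate_one one_pos hab₀ (τ₀ := -L) (T := 0) hL0 hb₀.le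
  obtain ⟨QΞ, hQΞ⟩ : ∃ Q : ℝ, Q = ∫ s in (-L)..0, ∫ x, ‖Ξ s x‖ ^ 2 := ⟨_, rfl⟩
  obtain ⟨IΞ, hIΞ_def⟩ : ∃ I : ℝ, I = ∫ q : ℝ × E, ‖Ξ q.1 q.2‖ ^ 2 := ⟨_, rfl⟩
  rw [← hQΞ] at hen0 hen1 hEΞ
  rw [← hIΞ_def]
  have h2L : 0 ≤ 2 * L := by linarith
  have hQΞI : QΞ ≤ IΞ := by
    rw [← hEΞ, hIΞ_def, ← restrict_slab_eq_prod]
    refine setIntegral_le_integral ?_ (Eventually.of_forall fun q => by positivity)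
    exact (hΞtop.contDiff.continuous.memLp_of_hasCompactSupport
      hΞtop.hasCompactSupport (p := 2)).integrable_sq.congr (Eventually.of_forall fun q => by
        show uncurry Ξ q ^ 2 = ‖Ξ q.1 q.2‖ ^ 2
        rw [Real.norm_eq_abs, sq_abs]; rfl)
  have hQΞ0 : 0 ≤ QΞ := by
    rw [← hEΞ]; exact integral_nonneg fun _ => by positivity
  have hIΞ0 : 0 ≤ IΞ := by rw [hIΞ_def]; exact integral_nonneg fun _ => by positivity
  -- Step E: term `A`: `|∫ locH · U| ≤ ‖locH‖₂ ‖v‖ √(2L) √IΞ`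
  have hUcont : Continuous fun q : ℝ × E => U q.1 q.2 :=
    (hΘt.contDiff_uncurry_heatDuhamelBack_infty one_pos).continuous
  have hUsq : Integrable (fun q : ℝ × E => ‖U q.1 q.2‖ ^ 2) μS :=
    (integral_sq_norm_heatDuhamelBack_slab' hΘt one_pos (-L) 0).1
  have hUle : ∀ q : ℝ × E, ‖U q.1 q.2‖ ^ 2 ≤ ‖v‖ ^ 2 * ∑ i, ‖fderiv ℝ (UΞ q.1) q.2 (bs i)‖ ^ 2 :=
    fun q => by rw [hUeq]; exact norm_fderiv_apply_sq_le (UΞ q.1) q.2 v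
  have hA_sq : ∫ q, ‖U q.1 q.2‖ ^ 2 ∂μS ≤ ‖v‖ ^ 2 * (2 * L * QΞ) := by
    calc ∫ q, ‖U q.1 q.2‖ ^ 2 ∂μS ≤ ∫ q, ‖v‖ ^ 2 * ∑ i, ‖fderiv ℝ (UΞ q.1) q.2 (bs i)‖ ^ 2 ∂μS :=
          integral_mono hUsq (hI1.const_mul _) hUle
      _ = ‖v‖ ^ 2 * ∫ s in (-L)..0, ∑ i, ∫ x, ‖fderiv ℝ (UΞ s) x (bs i)‖ ^ 2 := by
          rw [integral_const_mul, hE1]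
      _ ≤ ‖v‖ ^ 2 * (2 * L * QΞ) := by
          refine mul_le_mul_of_nonneg_left ?_ (sq_nonneg _)
          have : 2 * (0 - -L) / 1 * QΞ = 2 * L * QΞ := by ring
          rw [← this]; exact hen0
  have hA : |∫ q : ℝ × E, locH bs φ w' g' q * U q.1 q.2| ≤
      (eLpNorm (locH bs φ w' g') 2 (volume : Measure (ℝ × E))).toReal *
        (‖v‖ * Real.sqrt (2 * L) * Real.sqrt IΞ) := by
    have h0 : ∀ q : ℝ × E, q.1 ∉ Ioo (-L) 0 → locH bs φ w' g' q * U q.1 q.2 = 0 := by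
      intro q hq
      by_cases hqφ : q ∈ tsupport (uncurry φ)
      · have h1 := (hφsupp q hqφ).1
        have hq0 : 0 ≤ q.1 := by
          by_contra hlt
          exact hq ⟨by linarith, not_le.1 hlt⟩
        rw [hU0 q.1 (hb₀.le.trans hq0) q.2, mul_zero]
      · rw [locH_eq_zero_of_notMem bs w' g' hqφ, zero_mul]
    refine (abs_integral_mul_le_of_slab (memLp_locH bs hφ hw'm hg'm) hUcont hUsq h0).trans ?_
    refine mul_le_mul_of_nonneg_left ?_ ENNReal.toReal_nonneg
    calc Real.sqrt (∫ q, ‖U q.1 q.2‖ ^ 2 ∂μS) ≤ Real.sqrt (‖v‖ ^ 2 * (2 * L * IΞ)) := by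
          refine Real.sqrt_le_sqrt (hA_sq.trans ?_)
          exact mul_le_mul_of_nonneg_left (mul_le_mul_of_nonneg_left hQΞI h2L) (sq_nonneg _)
      _ = ‖v‖ * Real.sqrt (2 * L) * Real.sqrt IΞ := by
          rw [Real.sqrt_mul (sq_nonneg _), Real.sqrt_sq (norm_nonneg _),
            Real.sqrt_mul h2L, mul_assoc]
  -- Step F: terms `B i`: `|∫ locFᵢ · ∂ᵢU| ≤ ‖locFᵢ‖₂ ‖v‖ √n √IΞ`
  have hΘi : ∀ i, IsSpaceTimeTestOn (⊤ : Opens (ℝ × E)) (fun t y => fderiv ℝ (Θ t) y (bs i)) :=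
    fun i => hΘt.fderiv_apply_top (bs i)
  have hDi_eq : ∀ i (q : ℝ × E), fderiv ℝ (U q.1) q.2 (bs i) =
      heatDuhamelBack 1 (fun t y => fderiv ℝ (Θ t) y (bs i)) q.1 q.2 := fun i q =>
    hΘt.fderiv_heatDuhamelBack_apply one_pos q.1 q.2 (bs i)
  have hDcont : ∀ i, Continuous fun q : ℝ × E => fderiv ℝ (U q.1) q.2 (bs i) := fun i => by
    simp_rw [hDi_eq i]
    exact ((hΘi i).contDiff_uncurry_heatDuhamelBack_infty one_pos).continuous
  have hDsq : ∀ i, Integrable (fun q : ℝ × E => ‖fderiv ℝ (U q.1) q.2 (bs i)‖ ^ 2) μS := fun i => by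
    simp_rw [hDi_eq i]
    exact (integral_sq_norm_heatDuhamelBack_slab' (hΘi i) one_pos (-L) 0).1
  have hUΞ2 : ∀ s, ContDiff ℝ 2 (UΞ s) := fun s => hΞtop.contDiff_two_heatDuhamelBack one_pos s
  have hDle : ∀ i (q : ℝ × E), ‖fderiv ℝ (U q.1) q.2 (bs i)‖ ^ 2 ≤
      ‖v‖ ^ 2 * ∑ i', ∑ j, ‖fderiv ℝ (fun y => fderiv ℝ (UΞ q.1) y (bs i')) q.2 (bs j)‖ ^ 2 :=
    fun i q => by
    rw [hUfun q.1]
    have hd : DifferentiableAt ℝ (fderiv ℝ (UΞ q.1)) q.2 :=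
      (((hUΞ2 q.1).fderiv_right (m := 1) le_rfl).differentiable one_ne_zero) q.2
    have h := norm_fderiv_fderiv_apply_sq_le hd v (bs i)
    rw [bs.orthonormal.1 i, one_pow, mul_one] at h
    exact h
  have hB_sq : ∀ i, ∫ q, ‖fderiv ℝ (U q.1) q.2 (bs i)‖ ^ 2 ∂μS ≤ ‖v‖ ^ 2 * (n * QΞ) := fun i => by
    calc ∫ q, ‖fderiv ℝ (U q.1) q.2 (bs i)‖ ^ 2 ∂μS
        ≤ ∫ q, ‖v‖ ^ 2 * ∑ i', ∑ j, ‖fderiv ℝ (fun y => fderiv ℝ (UΞ q.1) y (bs i')) q.2 (bs j)‖ ^ 2 ∂μS :=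
          integral_mono (hDsq i) (hI2.const_mul _) (hDle i)
      _ = ‖v‖ ^ 2 * ∫ s in (-L)..0, ∑ i', ∑ j, ∫ x,
            ‖fderiv ℝ (fun y => fderiv ℝ (UΞ s) y (bs i')) x (bs j)‖ ^ 2 := by
          rw [integral_const_mul, hE2]
      _ ≤ ‖v‖ ^ 2 * (n * QΞ) := by
          refine mul_le_mul_of_nonneg_left ?_ (sq_nonneg _)
          have : (Module.finrank ℝ E : ℝ) / 1 ^ 2 * QΞ = n * QΞ := by rw [hnE]; ring
          rw [← this]; exact hen1
  have hB : ∀ i, |∫ q : ℝ × E, locF bs φ w' g' i q * fderiv ℝ (U q.1) q.2 (bs i)| ≤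
      (eLpNorm (locF bs φ w' g' i) 2 (volume : Measure (ℝ × E))).toReal *
        (‖v‖ * Real.sqrt n * Real.sqrt IΞ) := fun i => by
    have h0 : ∀ q : ℝ × E, q.1 ∉ Ioo (-L) 0 → locF bs φ w' g' i q * fderiv ℝ (U q.1) q.2 (bs i) = 0 := by
      intro q hq
      by_cases hqφ : q ∈ tsupport (uncurry φ)
      · have h1 := (hφsupp q hqφ).1
        have hq0 : 0 ≤ q.1 := by
          by_contra hlt
          exact hq ⟨by linarith, not_le.1 hlt⟩
        have hUs : U q.1 = 0 := funext fun x => hU0 q.1 (hb₀.le.trans hq0) x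
        rw [hUs]
        simp
      · rw [locF_eq_zero_of_notMem bs w' g' i hqφ, zero_mul]
    refine (abs_integral_mul_le_of_slab (memLp_locF bs hφ hw'm hg'm i) (hDcont i) (hDsq i) h0).trans ?_
    refine mul_le_mul_of_nonneg_left ?_ ENNReal.toReal_nonneg
    calc Real.sqrt (∫ q, ‖fderiv ℝ (U q.1) q.2 (bs i)‖ ^ 2 ∂μS) ≤ Real.sqrt (‖v‖ ^ 2 * (n * IΞ)) := by
          refine Real.sqrt_le_sqrt ((hB_sq i).trans ?_)
          exact mul_le_mul_of_nonneg_left (mul_le_mul_of_nonneg_left hQΞI hn0) (sq_nonneg _)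
      _ = ‖v‖ * Real.sqrt n * Real.sqrt IΞ := by
          rw [Real.sqrt_mul (sq_nonneg _), Real.sqrt_sq (norm_nonneg _), Real.sqrt_mul hn0, mul_assoc]
  -- Step G: the `L²` norms of the localised data
  obtain ⟨Nw, hNw_def⟩ : ∃ N : ℝ, N = (eLpNorm w 2 (volume.restrict Qs)).toReal := ⟨_, rfl⟩
  obtain ⟨Ng, hNg_def⟩ : ∃ N : ℝ, N = (eLpNorm g 2 (volume.restrict Qs)).toReal := ⟨_, rfl⟩
  rw [← hNw_def, ← hNg_def]
  have hNw0 : 0 ≤ Nw := by rw [hNw_def]; exact ENNReal.toReal_nonneg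
  have hNg0 : 0 ≤ Ng := by rw [hNg_def]; exact ENNReal.toReal_nonneg
  have hwtop : eLpNorm w 2 (volume.restrict Qs) ≠ ⊤ := hw.eLpNorm_ne_top
  have hgtop : eLpNorm g 2 (volume.restrict Qs) ≠ ⊤ := hg.eLpNorm_ne_top
  have hNH : (eLpNorm (locH bs φ w' g') 2 (volume : Measure (ℝ × E))).toReal ≤
      (Kt + Kl) * Nw + n * Kg * Ng := by
    have h := eLpNorm_locH_le bs hφ hw'm hg'm hKt0 hKl0 hKg0 hKt hKl hKgi
    rw [hNw, hNg] at h
    have hfin : ENNReal.ofReal (Kt + Kl) * eLpNorm w 2 (volume.restrict Qs) +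
        ENNReal.ofReal (n * Kg) * eLpNorm g 2 (volume.restrict Qs) ≠ ⊤ :=
      ENNReal.add_ne_top.2 ⟨ENNReal.mul_ne_top ENNReal.ofReal_ne_top hwtop,
        ENNReal.mul_ne_top ENNReal.ofReal_ne_top hgtop⟩
    refine (ENNReal.toReal_mono hfin h).trans (le_of_eq ?_)
    rw [ENNReal.toReal_add (ENNReal.mul_ne_top ENNReal.ofReal_ne_top hwtop)
      (ENNReal.mul_ne_top ENNReal.ofReal_ne_top hgtop), ENNReal.toReal_mul, ENNReal.toReal_mul,
      ENNReal.toReal_ofReal (by positivity), ENNReal.toReal_ofReal (by positivity), hNw_def, hNg_def]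
  have hNF : ∀ i, (eLpNorm (locF bs φ w' g' i) 2 (volume : Measure (ℝ × E))).toReal ≤
      Ng + 2 * Kg * Nw := fun i => by
    have h := eLpNorm_locF_le bs hφ hw'm hg'm zero_le_one hKg0 hK₀ hKgi i
    rw [hNw, hNg, ENNReal.ofReal_one, one_mul] at h
    have hfin : eLpNorm g 2 (volume.restrict Qs) +
        ENNReal.ofReal (2 * Kg) * eLpNorm w 2 (volume.restrict Qs) ≠ ⊤ :=
      ENNReal.add_ne_top.2 ⟨hgtop, ENNReal.mul_ne_top ENNReal.ofReal_ne_top hwtop⟩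
    refine (ENNReal.toReal_mono hfin h).trans (le_of_eq ?_)
    rw [ENNReal.toReal_add hgtop (ENNReal.mul_ne_top ENNReal.ofReal_ne_top hwtop),
      ENNReal.toReal_mul, ENNReal.toReal_ofReal (by positivity), hNw_def, hNg_def]
  -- Step H: assemble
  have hRHS : |(∫ q : ℝ × E, locH bs φ w' g' q * U q.1 q.2) -
      ∑ i, ∫ q : ℝ × E, locF bs φ w' g' i q * fderiv ℝ (U q.1) q.2 (bs i)| ≤
      ((Kt + Kl) * Nw + n * Kg * Ng) * (‖v‖ * Real.sqrt (2 * L) * Real.sqrt IΞ) +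
        n * ((Ng + 2 * Kg * Nw) * (‖v‖ * Real.sqrt n * Real.sqrt IΞ)) := by
    refine (abs_sub _ _).trans (add_le_add ?_ ?_)
    · exact hA.trans (mul_le_mul_of_nonneg_right hNH (by positivity))
    · refine (Finset.abs_sum_le_sum_abs _ _).trans ?_
      calc ∑ i, |∫ q : ℝ × E, locF bs φ w' g' i q * fderiv ℝ (U q.1) q.2 (bs i)|
          ≤ ∑ _i : Fin (Module.finrank ℝ E), (Ng + 2 * Kg * Nw) * (‖v‖ * Real.sqrt n * Real.sqrt IΞ) :=
            Finset.sum_le_sum fun i _ => (hB i).trans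
              (mul_le_mul_of_nonneg_right (hNF i) (by positivity))
        _ = n * ((Ng + 2 * Kg * Nw) * (‖v‖ * Real.sqrt n * Real.sqrt IΞ)) := by
            rw [Finset.sum_const, Finset.card_univ, nsmul_eq_mul]
  rw [← hLHS, key]
  refine hRHS.trans ?_
  clear key hRHS hLHS hA hB hNH hNF heq heq' hψ
  have h1 : (Kt + Kl) * Nw + n * Kg * Ng ≤ (Kt + Kl + n * Kg) * (Nw + Ng) := by
    nlinarith [mul_nonneg hKt0 hNg0, mul_nonneg hKl0 hNg0, mul_nonneg (mul_nonneg hn0 hKg0) hNw0]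
  have h2 : Ng + 2 * Kg * Nw ≤ (1 + 2 * Kg) * (Nw + Ng) := by
    nlinarith [mul_nonneg hKg0 hNg0]
  have hs0 : 0 ≤ ‖v‖ * Real.sqrt (2 * L) * Real.sqrt IΞ := by positivity
  have hs1 : 0 ≤ ‖v‖ * Real.sqrt n * Real.sqrt IΞ := by positivity
  calc ((Kt + Kl) * Nw + n * Kg * Ng) * (‖v‖ * Real.sqrt (2 * L) * Real.sqrt IΞ) +
        n * ((Ng + 2 * Kg * Nw) * (‖v‖ * Real.sqrt n * Real.sqrt IΞ))
      ≤ ((Kt + Kl + n * Kg) * (Nw + Ng)) * (‖v‖ * Real.sqrt (2 * L) * Real.sqrt IΞ) +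
        n * (((1 + 2 * Kg) * (Nw + Ng)) * (‖v‖ * Real.sqrt n * Real.sqrt IΞ)) :=
          add_le_add (mul_le_mul_of_nonneg_right h1 hs0)
            (mul_le_mul_of_nonneg_left (mul_le_mul_of_nonneg_right h2 hs1) hn0)
    _ = C * ‖v‖ * (Nw + Ng) * Real.sqrt IΞ := by rw [hC]; ring

/-- The pairing `w ∂ᵥΞ` of an `L²(Q)` function with the derivative of a test function supported in
`Q` is integrable. [folklore] -/
theorem integrable_mul_fderiv_test {Qs : Set (ℝ × E)} (hQo : IsOpen Qs) (hQfin : volume Qs < ⊤)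
    {w : ℝ × E → ℝ} (hw : MemLp w 2 (volume.restrict Qs)) {Ξ : ℝ → E → ℝ}
    (hΞ : IsSpaceTimeTestOn (⟨Qs, hQo⟩ : Opens (ℝ × E)) Ξ) (v : E) :
    Integrable (fun q : ℝ × E => w q * fderiv ℝ (Ξ q.1) q.2 v) (volume : Measure (ℝ × E)) := by
  have hQmeas : MeasurableSet Qs := hQo.measurableSet
  haveI : IsFiniteMeasure ((volume : Measure (ℝ × E)).restrict Qs) := isFiniteMeasure_restrict.2 hQfin.ne
  have hw'i : Integrable (Qs.indicator w) (volume : Measure (ℝ × E)) :=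
    IntegrableOn.integrable_indicator (hw.integrable one_le_two) hQmeas
  have hD : IsSpaceTimeTestOn (⊤ : Opens (ℝ × E)) (fun t x => fderiv ℝ (Ξ t) x v) :=
    (hΞ.mono le_top).fderiv_apply_top v
  have h := integrable_mul_of_continuous_hasCompactSupport hw'i hD.contDiff.continuous hD.hasCompactSupport
  refine h.congr (Eventually.of_forall fun q => ?_)
  show Qs.indicator w q * fderiv ℝ (Ξ q.1) q.2 v = w q * fderiv ℝ (Ξ q.1) q.2 v
  by_cases hq : q ∈ Qs
  · rw [indicator_of_mem hq]
  · have hq' : q ∉ tsupport (uncurry Ξ) := fun h => hq (hΞ.tsupport_subset h)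
    rw [IsSpaceTimeTestOn.fderiv_slice_eq_zero_of_notMem (ψ := Ξ) (t := q.1) (x := q.2) hq']
    simp

/-- **Interior `L²` gradient estimate for `∂ₜw - Δw = div g`, up to the top of the cylinder**
(the energy inequality for weak solutions of parabolic equations in divergence form,
Ladyzhenskaya–Solonnikov–Ural'tseva 1968, Ch. III §2; Lieberman 1996, Thm. 6.1; the first step of
Serrin's bootstrap, Lemarié-Rieusset 2016, Thm. 13.1, Step 2). For `0 < L' < L`, `0 < ρ' < ρ`
there is `C = C(L, L', ρ, ρ', dim E) ≥ 0` such that: if `w, g ∈ L²(Q)`,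
`Q = ]-L, 0[ × B(0, ρ)`, satisfy `∫ w (∂ₜψ + Δψ) = ∫ ⟪g, ∇ψ⟫` for all `ψ ∈ C_c^∞(Q)`, then for
every direction `v` the distributional derivative `∂ᵥw` is a function `G ∈ L²(Q')` on the inner
cylinder `Q' = ]-L', 0[ × B(0, ρ')` sharing the top — `∫ w ∂ᵥΞ = -∫_{Q'} G Ξ` for all
`Ξ ∈ C_c^∞(Q')` — with `‖G‖_{L²(Q')} ≤ C ‖v‖ (‖w‖_{L²(Q)} + ‖g‖_{L²(Q)})`. Proof: the duality bound
`abs_integral_mul_fderiv_test_le` and Riesz–Fréchet `exists_memLp_two_repr_of_test_bound`.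
[folklore] -/
theorem heatDivForm_gradient_L2_top {L L' ρ ρ' : ℝ} (hL' : 0 < L') (hL : L' < L)
    (hρ' : 0 < ρ') (hρ : ρ' < ρ) :
    ∃ C : ℝ, 0 ≤ C ∧ ∀ (w : ℝ × E → ℝ) (g : ℝ × E → E),
      MemLp w 2 (volume.restrict (Ioo (-L) 0 ×ˢ ball (0 : E) ρ)) →
      MemLp g 2 (volume.restrict (Ioo (-L) 0 ×ˢ ball (0 : E) ρ)) →
      (∀ ψ : ℝ → E → ℝ,
        IsSpaceTimeTestOn (⟨Ioo (-L) 0 ×ˢ ball (0 : E) ρ, isOpen_Ioo.prod isOpen_ball⟩ :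
          Opens (ℝ × E)) ψ →
        ∫ q : ℝ × E, w q * (timeDeriv ψ q.1 q.2 + (Δ (ψ q.1)) q.2) =
          ∫ q : ℝ × E, ⟪g q, gradient (ψ q.1) q.2⟫) →
      ∀ v : E, ∃ G : ℝ × E → ℝ,
        MemLp G 2 (volume.restrict (Ioo (-L') 0 ×ˢ ball (0 : E) ρ')) ∧
        eLpNorm G 2 (volume.restrict (Ioo (-L') 0 ×ˢ ball (0 : E) ρ')) ≤
          ENNReal.ofReal (C * ‖v‖ *
            ((eLpNorm w 2 (volume.restrict (Ioo (-L) 0 ×ˢ ball (0 : E) ρ))).toReal +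
              (eLpNorm g 2 (volume.restrict (Ioo (-L) 0 ×ˢ ball (0 : E) ρ))).toReal)) ∧
        ∀ Ξ : ℝ → E → ℝ,
          IsSpaceTimeTestOn (⟨Ioo (-L') 0 ×ˢ ball (0 : E) ρ', isOpen_Ioo.prod isOpen_ball⟩ :
            Opens (ℝ × E)) Ξ →
          ∫ q : ℝ × E, w q * fderiv ℝ (Ξ q.1) q.2 v =
            -∫ q in Ioo (-L') 0 ×ˢ ball (0 : E) ρ', G q * Ξ q.1 q.2 := by
  obtain ⟨C, hC0, hC⟩ := abs_integral_mul_fderiv_test_le (E := E) hL' hL hρ' hρ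
  refine ⟨C, hC0, fun w g hw hg heq v => ?_⟩
  set Qs : Set (ℝ × E) := Ioo (-L) 0 ×ˢ ball (0 : E) ρ with hQs
  set Qs' : Set (ℝ × E) := Ioo (-L') 0 ×ˢ ball (0 : E) ρ' with hQs'
  set Qo' : Opens (ℝ × E) := ⟨Qs', isOpen_Ioo.prod isOpen_ball⟩ with hQo'
  have hQ'meas : MeasurableSet Qs' := (isOpen_Ioo.prod isOpen_ball).measurableSet
  have hQ'Q : Qs' ⊆ Qs := prod_mono (Ioo_subset_Ioo (by linarith) le_rfl) (ball_subset_ball hρ.le)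
  have hQfin : volume Qs < ⊤ := by
    rw [hQs, Measure.volume_eq_prod, Measure.prod_prod]
    exact ENNReal.mul_lt_top (by simp [Real.volume_Ioo]) measure_ball_lt_top
  have hQ'fin : volume Qs' < ⊤ := lt_of_le_of_lt (measure_mono hQ'Q) hQfin
  have hwQ' : MemLp w 2 (volume.restrict Qs') := hw.mono_measure (Measure.restrict_mono hQ'Q le_rfl)
  set N : ℝ := (eLpNorm w 2 (volume.restrict Qs)).toReal + (eLpNorm g 2 (volume.restrict Qs)).toReal
    with hN
  -- curried form of an uncurried test function
  have hcur : ∀ {θ : ℝ × E → ℝ}, Literature.Analysis.FunctionSpaces.IsTestFunctionOn Qo' θ →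
      IsSpaceTimeTestOn Qo' (fun t x => θ (t, x)) := fun hθ => hθ
  -- the functional
  set Λ : (ℝ × E → ℝ) → ℝ := fun θ => -∫ q : ℝ × E, w q * fderiv ℝ (fun x => θ (q.1, x)) q.2 v with hΛ
  have hint : ∀ {θ : ℝ × E → ℝ}, Literature.Analysis.FunctionSpaces.IsTestFunctionOn Qo' θ →
      Integrable (fun q : ℝ × E => w q * fderiv ℝ (fun x => θ (q.1, x)) q.2 v) (volume : Measure (ℝ × E)) :=
    fun hθ => integrable_mul_fderiv_test (isOpen_Ioo.prod isOpen_ball) hQ'fin hwQ' (hcur hθ) v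
  have hdiff : ∀ {θ : ℝ × E → ℝ}, Literature.Analysis.FunctionSpaces.IsTestFunctionOn Qo' θ →
      ∀ q : ℝ × E, DifferentiableAt ℝ (fun x => θ (q.1, x)) q.2 := fun hθ q =>
    (((hcur hθ).contDiff_slice q.1).differentiable (by simp)) q.2
  have hadd : ∀ f g' : ℝ × E → ℝ, Literature.Analysis.FunctionSpaces.IsTestFunctionOn Qo' f →
      Literature.Analysis.FunctionSpaces.IsTestFunctionOn Qo' g' → Λ (f + g') = Λ f + Λ g' := by
    intro f g' hf hg'
    simp only [hΛ]
    rw [← neg_add, ← integral_add (hint hf) (hint hg')]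
    congr 1
    refine integral_congr_ae (Eventually.of_forall fun q => ?_)
    have : (fun x => (f + g') (q.1, x)) = (fun x => f (q.1, x)) + fun x => g' (q.1, x) := rfl
    show w q * fderiv ℝ (fun x => (f + g') (q.1, x)) q.2 v =
      w q * fderiv ℝ (fun x => f (q.1, x)) q.2 v + w q * fderiv ℝ (fun x => g' (q.1, x)) q.2 v
    rw [this, fderiv_add (hdiff hf q) (hdiff hg' q)]
    simp only [_root_.add_apply]
    ring
  have hsmul : ∀ (a : ℝ) (f : ℝ × E → ℝ), Literature.Analysis.FunctionSpaces.IsTestFunctionOn Qo' f →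
      Λ (a • f) = a * Λ f := by
    intro a f hf
    simp only [hΛ]
    rw [mul_neg, ← integral_const_mul]
    congr 1
    refine integral_congr_ae (Eventually.of_forall fun q => ?_)
    have : (fun x => (a • f) (q.1, x)) = a • fun x => f (q.1, x) := rfl
    show w q * fderiv ℝ (fun x => (a • f) (q.1, x)) q.2 v = a * (w q * fderiv ℝ (fun x => f (q.1, x)) q.2 v)
    rw [this, fderiv_const_smul (hdiff hf q)]
    simp only [_root_.smul_apply, smul_eq_mul]
    ring
  have hbd : ∀ f : ℝ × E → ℝ, Literature.Analysis.FunctionSpaces.IsTestFunctionOn Qo' f →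
      |Λ f| ≤ C * ‖v‖ * N * (eLpNorm f 2 (volume.restrict Qs')).toReal := by
    intro f hf
    simp only [hΛ, abs_neg]
    have h := hC w g hw hg heq v (fun t x => f (t, x)) (hcur hf)
    refine h.trans (le_of_eq ?_)
    rw [hN]
    congr 1
    have hf2 : MemLp f 2 (volume.restrict Qs') :=
      (hf.contDiff.continuous.memLp_of_hasCompactSupport hf.hasCompactSupport).restrict _
    rw [toReal_eLpNorm_two_eq_sqrt hf2]
    congr 1
    refine (setIntegral_eq_integral_of_forall_compl_eq_zero fun q hq => ?_).symm
    have : f q = 0 := image_eq_zero_of_notMem_tsupport fun h' => hq (hf.tsupport_subset h')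
    rw [show f (q.1, q.2) = f q from rfl, this]; simp
  obtain ⟨G, hGm, hGn, hGrep⟩ := exists_memLp_two_repr_of_test_bound (volume : Measure (ℝ × E)) Qo' Λ
    hadd hsmul (by positivity : 0 ≤ C * ‖v‖ * N) hbd
  refine ⟨G, hGm, hGn, fun Ξ hΞ => ?_⟩
  have h := hGrep (uncurry Ξ) hΞ
  simp only [hΛ] at h
  have h' : -∫ q : ℝ × E, w q * fderiv ℝ (Ξ q.1) q.2 v = ∫ q in Qs', G q * Ξ q.1 q.2 := h
  rw [← h', neg_neg]

end GradientL2

end HeatDivForm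

end Literature.Analysis.FluidPDE

end
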